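import Summits.HodgeConjecture.HodgeConjecture.Theorems.F0LD1ThetaSliceBricks
import Summits.HodgeConjecture.HodgeConjecture.Theorems.F0LD1ThetaClassHermiteSum
import HarnessLib

-- statements over the theta-kernel datum elaborate to very large types; elaborate sequentially (as in the ★ kit lineage)
set_option Elab.async false

/-!
# Crux `HLiu418`, line LD1 — brick (Gβ-Σ) `HermiteSum` HOLDS (organ payment, LD1-p01 (g3))

`theorem hermiteSum_holds : F0LD1ThetaSliceOfBricks.HermiteSum` — the FOLDED head constant of ★ `Theorems.F0LD1ThetaSliceBricks`
(junction v4 of LD1-plan (g2); referee ruling LD-ref1 (g2) 2026-09-02T09:57:23Z: closers state the folded constant, no unfolded 40-binder heads).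
Every pure-tensor theta class `[θ^{μ_W}_{φ ⊗ Φ_f}]` is the `L²`-convergent sum `Σ_β c_β • [θ^{μ_W}_{h_β ⊗ Φ_f}]` of its Hermite pure-tensor
components at the frame `frameV …` of the line `W = L · lineW`: ONE application of ★
`F0LD1ThetaClassHermiteSum.hasSum_follandCoeff_smul_thetaClass_follandHermite` (LD1-p01 (g2), p850775), after deriving in the body — by the
SAME terms as the brick's `haveI`s — the compactness of `[U(H)]` (a definite place exists since `[L:ℚ] ≥ 4`) and the kit transport pair
`hT = ⟨continuous_of_pin …, mem_range_toAdelic_of_pin …⟩` of the pinned `ιA` (★ `F0LD2FrameTransportPin`).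

HONEST LABEL. HC_CM is proved only modulo the 7 printed citations (2 remaining: hLiu418 = stmt-HodgeConjecture-24832,
h413 = stmt-HodgeConjecture-24833) until rung 0 closes; this file discharges one in-house brick of line LD1 and nothing printed; count-neutral.
References (prose locators): Folland 1989 §1.7 (1.81); Weil 1964 Chap. III n° 41.
-/

set_option autoImplicit false
set_option linter.dupNamespace false

noncomputable section

open NumberField NumberField.InfinitePlace MeasureTheory IsDedekindDomain
open scoped Matrix Kronecker ComplexOrder ENNReal TensorProduct SchwartzMap InnerProductSpace ComplexConjugate Classical
open Literature.NumberTheory.Automorphic Literature.NumberTheory.Automorphic.UnitaryGroup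
open Literature.NumberTheory.Automorphic.UnitaryGroup.CotangentForms (toQuotFun)
open Literature.NumberTheory.Automorphic.UnitaryCurveForms
open Literature.NumberTheory.Automorphic.Liu2021 Literature.NumberTheory.Automorphic.Liu2021.Def411WeilCarriers
open Literature.NumberTheory.Automorphic.Liu2021.Def411WeilCarriersDoubling
open Literature.NumberTheory.Automorphic.Liu2021.CinfThetaTorus
open Literature.NumberTheory.GaloisRepresentations Literature.NumberTheory.Automorphic.IdeleClassGroup
open Literature.NumberTheory.GelbartRogawski1991 Literature.NumberTheory.GelbartRogawski1991.UnitaryDualPair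
open Literature.NumberTheory.GelbartRogawski1991.UnitaryDualPair.WeilCoinv
open Literature.NumberTheory.GelbartRogawski1991.GRConstruction
open Literature.NumberTheory.Weil1964
open Literature.RepresentationTheory.Liu2021 Literature.RepresentationTheory.HarrisKudlaSweet1996
open Literature.RepresentationTheory.HeisenbergGroup Literature.Analysis.SegalBargmann
open Literature.RepresentationTheory.KonnoKonno2007 Literature.RepresentationTheory.KonnoKonno2007.RealDualPair
open Literature.RepresentationTheory.CompactGroups
open Literature.NumberTheory.Rogawski1990
open Summit.HodgeConjecture.HodgeConjecture.Cruxes.HLiu418.F0LD1ThetaTransportKit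
open Summit.HodgeConjecture.HodgeConjecture.Cruxes.HLiu418.F0LD2ThetaTensorClasses
open Summit.HodgeConjecture.HodgeConjecture.Cruxes.HLiu418.F0LD2FrameTransportPin
open Summit.HodgeConjecture.HodgeConjecture.Cruxes.HLiu418.F0LD1ThetaGermDefs
open Summit.HodgeConjecture.HodgeConjecture.Cruxes.HLiu418.F0LD1ThetaClassHermiteSum

namespace Summit.HodgeConjecture.HodgeConjecture.Cruxes.HLiu418.F0LD1ThetaSliceHermiteSum

/-- **(Gβ-Σ) `HermiteSum` HOLDS** (folded head): every pure-tensor theta class is the `L²`-sum of its Hermite components,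
`∃ c, HasSum (β ↦ c β • [θ^{μ_W}_{h_β ⊗ Φ_f}]) [θ^{μ_W}_{φ ⊗ Φ_f}]`, with `c β = hermiteCoeff β …` — ★
`hasSum_follandCoeff_smul_thetaClass_follandHermite` at the frame `frameV L e₁ dV hdV hdV0 (lineW …) …`.
[cite: Folland1989, §1.7 (1.81)] [cite: Weil1964, Chap. III n° 41 Thm 6 p. 193] -/
theorem hermiteSum_holds : F0LD1ThetaSliceOfBricks.HermiteSum := by
  intro L _ _ _ ι H dV hdV hdV0 t ht g hg _hsig hdef hdeg μ _ n' e₁ lam hlam _hw ιA hpin _ a' ξ hρ μW _ _ φ Φf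
  haveI : CompactSpace (adelicGroupData (↥(maximalRealSubfield L)) L (IsCMField.complexConj L) 2 H).automorphicQuotient :=
    (UnitaryGroup.exists_infinitePlace_ne L hdeg ι).elim fun τ hτ =>
      UnitaryGroup.compactSpace_adelicGroupData_automorphicQuotient L 2 H
        (UnitaryGroup.anisotropic_of_formCongr_smul_eq_of_posDef L 2 H dV t ht g hg τ (hdef τ hτ))
  have hT : Continuous ιA ∧ ∀ ⦃γ : (adelicGroupData (↥(maximalRealSubfield L)) L (IsCMField.complexConj L) 2 H).Adelic⦄,
      γ ∈ (UnitaryGroup.toAdelic (↥(maximalRealSubfield L)) L (IsCMField.complexConj L) 2 H).range →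
        ιA γ ∈ (UnitaryGroup.toAdelic (↥(maximalRealSubfield L)) L (IsCMField.complexConj L) 2 (Matrix.diagonal dV)).range :=
    ⟨continuous_of_pin L 2 H dV g ιA hpin, fun _ hγ => mem_range_toAdelic_of_pin L 2 H dV t ht g hg ιA hpin hγ⟩
  letI : MeasurableSpace (↥(UnitaryGroup.adelic (↥(maximalRealSubfield L)) L (IsCMField.complexConj L) 1 (JW (↥(maximalRealSubfield L)) L a')) ⧸ (UnitaryGroup.toAdelic (↥(maximalRealSubfield L)) L (IsCMField.complexConj L) 1 (JW (↥(maximalRealSubfield L)) L a')).range) := borel _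
  haveI : BorelSpace (↥(UnitaryGroup.adelic (↥(maximalRealSubfield L)) L (IsCMField.complexConj L) 1 (JW (↥(maximalRealSubfield L)) L a')) ⧸ (UnitaryGroup.toAdelic (↥(maximalRealSubfield L)) L (IsCMField.complexConj L) 1 (JW (↥(maximalRealSubfield L)) L a')).range) := ⟨rfl⟩
  haveI := normal_range_toAdelic_JW L a'
  exact ⟨_, hasSum_follandCoeff_smul_thetaClass_follandHermite L 2 H e₁ dV hdV hdV0 ιA hT lam hlam a' hρ μW (charCM ξ) μ
    (frameV L e₁ dV hdV hdV0 (lineW L (TW (Fp L) a')) (complexConj_lineW L (TW (Fp L) a'))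
      (lineW_ne_zero L (TW (Fp L) a') (isUnit_det_TW (Fp L) a'))) Φf φ⟩

end Summit.HodgeConjecture.HodgeConjecture.Cruxes.HLiu418.F0LD1ThetaSliceHermiteSum

end
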